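import Summits.Ventures.CertifiedQuantumChemistry.Rows.SingletUpperSpinBound
import Literature.MathematicalPhysics.QuantumChemistry.VariationalRDMRelaxation
import HarnessLib

/-!
# Ventures/CertifiedQuantumChemistry — Rows/MaximalSpinProjectionRows.lean: the `s2v`
# maximal-spin-projection rows (FORMAT-qcl1 §5 E4) are valid, and redundant given `G ⪰ 0` + E3

HONEST FRAMING (verbatim): certified bounds for a stated model Hamiltonian in a stated basis; not a
claim about the real molecule beyond that model.

Seat rdm-B (generator B `HOME/code/qchem_rdm_b/gen_b.py` ≥ 0.3.0, option `--s2v`); ROWS courtesy file —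
the typer's adopt / refactor / retire word applies; nothing here asserts a bound; no claim node, no def.
FORMAT-qcl1 §5 adds to a programme of the spin class `S = M` (E3: `ω(Ŝ_−Ŝ_+) = S(S+1) − M(M+1) = 0`)
the MAXIMAL-PROJECTION VECTOR ROWS E4a `ω(a†_{pβ} a_{qα} Ŝ_+) = 0` for all `k²` pairs `(p, q)` and, only
when `2S = 0`, E4b `ω(Ŝ_+ a†_{pβ} a_{qα}) = 0`; expanded with the CAR they read
`γ^β_{pq} − Σ_r Γ^{αβ}[(r,p),(q,r)] = 0` resp. `γ^α_{pq} − Σ_r Γ^{αβ}[(r,p),(q,r)] = 0`. Its VALIDITY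
sentence ("every state of the E3 class is annihilated by `Ŝ_+` ⇒ E4a; for `S = M = 0` also by `Ŝ_−` ⇒
E4b") and its REDUNDANCY LEMMA ("`Ŝ_−Ŝ_+ = Σ_{rs} m_r† m_s` with `m_r = a†_{rα}a_{rβ} ∈ members(G_ab)`, so
E3 reads `vᵀ G v = 0`; with `G ⪰ 0` this forces `G v = 0` = the E4a rows; for `2S = 0`,
`uᵀ G u = ω(Ŝ_+Ŝ_−) = ω(Ŝ_−Ŝ_+) + (tr γ^α − tr γ^β) = 0` by E3 + E1, forcing `G u = 0` = the E4b rows;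
hence feasible(`s2v`) = feasible(`s2`)") are PROVED here in the tree's vocabulary (`spinPlus`,
`spinMinus = spinPlusᴴ`, `IsInSector`, `oneRDM`, `twoRDM`, `particleHoleRDM` = `²G` with
`²G^{ij}_{kl} = ⟨ψ|a†_i a_j a†_l a_k|ψ⟩`, the abstract `G`-map `gMap γ Γ` and `IsDQGFeasibleSector` of
`VariationalRDMRelaxation.lean`):

* §1 STATE LEVEL. `expect_mul_spinPlus_eq_zero` (`Ŝ_+ψ = 0 ⇒ ⟨ψ|X Ŝ_+|ψ⟩ = 0`, E4a in operator form);
  **`spinMinus_mulVec_eq_zero_of_balanced`** (in the balanced sector `(n, n)` a vector annihilated by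
  `Ŝ_+` is annihilated by `Ŝ_−` — it is a singlet); `expect_spinPlus_mul_eq_zero` (E4b in operator
  form); the rows on the reduced density matrices: `sum_particleHoleRDM_spinPlus_eq_zero`
  (`Σ_r ²G^{(i,j)}_{(rβ,rα)} = 0`), `oneRDM_down_eq_sum_twoRDM` (E4a expanded:
  `¹D^{pβ}_{qβ} = Σ_r ²D^{(pβ,rα)}_{(rβ,qα)}`), `sum_particleHoleRDM_spinMinus_eq_zero`,
  `oneRDM_up_eq_sum_twoRDM` (E4b expanded, balanced sector: `¹D^{pα}_{qα} = Σ_r ²D^{(rα,pβ)}_{(qα,rβ)}`),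
  their difference `oneRDM_up_eq_oneRDM_down_of_singlet` (`γ^α = γ^β` for a singlet — §5 "Relations:
  E4a(p,q) − E4b(p,q) = γ^β_{pq} − γ^α_{pq}"); and E3 at state level,
  `sum_particleHoleRDM_eq_norm_spinPlus` (`Σ_{pq} ²G^{(pβ,pα)}_{(qβ,qα)} = ‖Ŝ_+ψ‖²`).
* §2 ABSTRACT PAIRS (the redundancy lemma). For ANY pair `(γ, Γ)` with `gMap γ Γ ⪰ 0`:
  **`gMap_maximalProjection_of_E3`** — the E3 row `Σ_{pq} G_{(pβ,pα),(qβ,qα)} = 0` forces every E4a row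
  `Σ_r G_{m,(rβ,rα)} = 0`; **`gMap_maximalProjection_flip_of_E3`** — with fermionic antisymmetry of `Γ`
  and equal spin traces `tr γ^α = tr γ^β` (the balanced sector's E1 rows) it also forces every E4b row
  `Σ_r G_{m,(rα,rβ)} = 0`; packaged for the cell's feasible set as
  `IsDQGFeasibleSector.maximalProjection_of_E3` (`(n, n)`, both families). Tool: a PSD matrix kills
  every vector on which its form vanishes (Mathlib `Matrix.PosSemidef.dotProduct_mulVec_zero_iff`).

Everything is PROVED (0 sorry, 0 def). References: FORMAT-qcl1 v0.3.0 §5 E3/E4 + REDUNDANCY LEMMA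
(`HOME/pub-qchem-rdm/FORMAT-qcl1.md`; generator A 0.2.1 / generator B 0.3.0, A ≡ B on all 18 `s2v`
instances of record, AB-AGREEMENT §V); J. Fosso-Tande, T.-S. Nguyen, G. Gidofalvi, A. E. DePrince III,
J. Chem. Theory Comput. 12 (2016) 2260 (maximal-spin-projection constraints `⟨a†_p a_q Ŝ_+⟩ = 0` in
v2RDM codes); D. A. Mazziotti, Adv. Chem. Phys. 134 (2007) ch. 3 §II.F.1 eqs. (96)–(98)
(`S`-representability through `Ŝ_−Ŝ_+`; tree `RDMSpinSectorConditions.lean`); H. Tasaki, *Physics and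
Mathematics of Quantum Many-Body Systems* (2020) App. A.3 (`Ŝ²ψ = 0 ⇒ Ŝ_±ψ = 0`; tree
`spin_mulVec_eq_zero_of_spinSq_mulVec_eq_zero`).
-/

noncomputable section

namespace Summit.Ventures.CertifiedQuantumChemistry

open Matrix Finset
open Literature.MathematicalPhysics.QuantumLattice Literature.MathematicalPhysics.QuantumChemistry
open scoped ComplexOrder

variable {Λ : Type*} [LinearOrder Λ] [Fintype Λ]

/-! ## §1 The rows at state level -/

/-- **E4a in operator form**: a vector annihilated by `Ŝ_+` has `⟨ψ| X Ŝ_+ |ψ⟩ = 0` for every `X`. -/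
theorem expect_mul_spinPlus_eq_zero {ψ : Fock (Orb Λ)} (hP : spinPlus *ᵥ ψ = 0)
    (X : Matrix (Finset (Orb Λ)) (Finset (Orb Λ)) ℂ) : star ψ ⬝ᵥ (X * spinPlus) *ᵥ ψ = 0 := by
  rw [← mulVec_mulVec, hP, mulVec_zero, dotProduct_zero]

/-- **E4b in operator form**: a vector annihilated by `Ŝ_−` has `⟨ψ| Ŝ_+ X |ψ⟩ = ⟨Ŝ_−ψ, Xψ⟩ = 0`. -/
theorem expect_spinPlus_mul_eq_zero {ψ : Fock (Orb Λ)} (hM : spinMinus *ᵥ ψ = 0)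
    (X : Matrix (Finset (Orb Λ)) (Finset (Orb Λ)) ℂ) : star ψ ⬝ᵥ (spinPlus * X) *ᵥ ψ = 0 := by
  have h : star ψ ᵥ* spinPlus = star (spinMinus *ᵥ ψ) := by
    rw [star_mulVec, spinMinus, conjTranspose_conjTranspose]
  rw [← mulVec_mulVec, dotProduct_mulVec, h, hM, star_zero, zero_dotProduct]

/-- **In the balanced sector a highest-weight vector is a singlet**: for `ψ` in the sector
`(N_α, N_β) = (n, n)` (so `Ŝ_z ψ = 0`), `Ŝ_+ ψ = 0` implies `Ŝ_− ψ = 0` (`Ŝ² = Ŝ_z² + Ŝ_z + Ŝ_−Ŝ_+`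
kills `ψ`, hence so does every spin component). This is the `S = M = 0` clause behind E4b. -/
theorem spinMinus_mulVec_eq_zero_of_balanced {n : ℕ} {ψ : Fock (Orb Λ)} (hψ : IsInSector n n ψ)
    (hP : spinPlus *ᵥ ψ = 0) : spinMinus *ᵥ ψ = 0 := by
  have hz : HubbardWave0.spinZ *ᵥ ψ = 0 := by
    have h := ((mem_szSector_iff _ _ ψ).1 ((mem_szSector_iff_isInSector n n ψ).2 hψ)).2
    rw [h, sub_self, zero_div, Complex.ofReal_zero, zero_smul]
  have hS : spinSq *ᵥ ψ = 0 := by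
    rw [spinSq_mulVec_of_spinZ_eq_zero hz, hP, mulVec_zero]
  exact (spin_mulVec_eq_zero_of_spinSq_mulVec_eq_zero hS).2.1

/-- **E4a on the reduced density matrices**: `Σ_r ²G^{(i,j)}_{(rβ,rα)} = ⟨ψ| a†_i a_j Ŝ_+ |ψ⟩ = 0` for a
vector annihilated by `Ŝ_+` (any `i, j`; the cell's rows take `i = pβ`, `j = qα`). -/
theorem sum_particleHoleRDM_spinPlus_eq_zero {ψ : Fock (Orb Λ)} (hP : spinPlus *ᵥ ψ = 0)
    (i j : Orb Λ) : ∑ r : Λ, particleHoleRDM ψ (i, j) (orb r 1, orb r 0) = 0 := by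
  calc ∑ r : Λ, particleHoleRDM ψ (i, j) (orb r 1, orb r 0)
      = star ψ ⬝ᵥ (creation i * annihilation j * spinPlus) *ᵥ ψ := by
        simp only [particleHoleRDM, spinPlus, Finset.mul_sum, Matrix.sum_mulVec, dotProduct_sum,
          Matrix.mul_assoc]
    _ = 0 := expect_mul_spinPlus_eq_zero hP _

/-- **E4a expanded** (`γ^β_{pq} = Σ_r Γ^{αβ}…`): for a vector annihilated by `Ŝ_+`,
`¹D^{pβ}_{qβ} = Σ_r ²D^{(pβ, rα)}_{(rβ, qα)}` (from `²G^{ij}_{kl} = δ_{jl} ¹D^i_k − ²D^{il}_{kj}`). -/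
theorem oneRDM_down_eq_sum_twoRDM {ψ : Fock (Orb Λ)} (hP : spinPlus *ᵥ ψ = 0) (p q : Λ) :
    oneRDM ψ (orb p 1) (orb q 1) = ∑ r : Λ, twoRDM ψ (orb p 1, orb r 0) (orb r 1, orb q 0) := by
  have h := sum_particleHoleRDM_spinPlus_eq_zero hP (orb p 1) (orb q 0)
  simp only [particleHoleRDM_apply, Finset.sum_sub_distrib, orb_inj, and_true, Finset.sum_ite_eq,
    Finset.mem_univ, if_true] at h
  exact sub_eq_zero.1 h

/-- **E4b on the reduced density matrices**: `Σ_r ²G^{(rα,rβ)}_{(k,l)} = ⟨ψ| Ŝ_+ a†_l a_k |ψ⟩ = 0` for a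
vector annihilated by `Ŝ_−` (any `k, l`; the cell's rows take `l = pβ`, `k = qα`). -/
theorem sum_particleHoleRDM_spinMinus_eq_zero {ψ : Fock (Orb Λ)} (hM : spinMinus *ᵥ ψ = 0)
    (k l : Orb Λ) : ∑ r : Λ, particleHoleRDM ψ (orb r 0, orb r 1) (k, l) = 0 := by
  calc ∑ r : Λ, particleHoleRDM ψ (orb r 0, orb r 1) (k, l)
      = star ψ ⬝ᵥ (spinPlus * (creation l * annihilation k)) *ᵥ ψ := by
        simp only [particleHoleRDM, spinPlus, Finset.sum_mul, Matrix.sum_mulVec, dotProduct_sum,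
          Matrix.mul_assoc]
    _ = 0 := expect_spinPlus_mul_eq_zero hM _

/-- **E4b expanded** (`γ^α_{pq} = Σ_r Γ^{αβ}[(r,p),(q,r)]`, the `2S = 0` rows): in the balanced sector,
for a vector annihilated by `Ŝ_+`, `¹D^{pα}_{qα} = Σ_r ²D^{(rα, pβ)}_{(qα, rβ)}`. -/
theorem oneRDM_up_eq_sum_twoRDM {n : ℕ} {ψ : Fock (Orb Λ)} (hψ : IsInSector n n ψ)
    (hP : spinPlus *ᵥ ψ = 0) (p q : Λ) :
    oneRDM ψ (orb p 0) (orb q 0) = ∑ r : Λ, twoRDM ψ (orb r 0, orb p 1) (orb q 0, orb r 1) := by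
  have h := sum_particleHoleRDM_spinMinus_eq_zero (spinMinus_mulVec_eq_zero_of_balanced hψ hP)
    (orb q 0) (orb p 1)
  simp only [particleHoleRDM_apply, Finset.sum_sub_distrib, orb_inj, and_true, Finset.sum_ite_eq',
    Finset.mem_univ, if_true] at h
  exact sub_eq_zero.1 h

/-- **E4a − E4b = `γ^β_{pq} − γ^α_{pq}`** (FORMAT-qcl1 §5 "Relations"): in the balanced sector a vector
annihilated by `Ŝ_+` (a singlet) has a SPIN-SYMMETRIC 1-RDM, `¹D^{pα}_{qα} = ¹D^{pβ}_{qβ}` — both rows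
have the same two-body part `Σ_r Γ^{αβ}[(r,p),(q,r)]` once `²D` is re-sorted by antisymmetry. -/
theorem oneRDM_up_eq_oneRDM_down_of_singlet {n : ℕ} {ψ : Fock (Orb Λ)} (hψ : IsInSector n n ψ)
    (hP : spinPlus *ᵥ ψ = 0) (p q : Λ) : oneRDM ψ (orb p 0) (orb q 0) = oneRDM ψ (orb p 1) (orb q 1) := by
  rw [oneRDM_up_eq_sum_twoRDM hψ hP, oneRDM_down_eq_sum_twoRDM hP]
  refine Finset.sum_congr rfl fun r _ => ?_
  rw [twoRDM_swap_fst, twoRDM_swap_snd, neg_neg]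

/-- **E3 at state level**: `Σ_{pq} ²G^{(pβ,pα)}_{(qβ,qα)} = ⟨ψ|Ŝ_−Ŝ_+|ψ⟩ = ‖Ŝ_+ψ‖²` — the E3 row is the
form of `²G` on the indicator `v` of the members `a†_{rβ}… `; it vanishes iff `Ŝ_+ψ = 0`. -/
theorem sum_particleHoleRDM_eq_norm_spinPlus (ψ : Fock (Orb Λ)) :
    ∑ p : Λ, ∑ q : Λ, particleHoleRDM ψ (orb p 1, orb p 0) (orb q 1, orb q 0) =
      star (spinPlus *ᵥ ψ) ⬝ᵥ (spinPlus *ᵥ ψ) := by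
  have hR : star (spinPlus *ᵥ ψ) ⬝ᵥ (spinPlus *ᵥ ψ) = star ψ ⬝ᵥ (spinMinus * spinPlus) *ᵥ ψ := by
    rw [star_mulVec, ← dotProduct_mulVec, spinMinus, mulVec_mulVec]
  rw [hR, spinMinus_eq_sum, spinPlus]
  simp only [particleHoleRDM, Finset.sum_mul, Finset.mul_sum, Matrix.sum_mulVec, dotProduct_sum,
    Matrix.mul_assoc]
  exact Finset.sum_comm

/-! ## §2 The redundancy lemma on abstract pairs: `G ⪰ 0` + E3 (+ E1) force the E4 rows -/

section Abstract

variable {γ : Matrix (Orb Λ) (Orb Λ) ℂ} {Γ : Matrix (Orb Λ × Orb Λ) (Orb Λ × Orb Λ) ℂ}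

/-- The form of a matrix on the indicator of a family of indices, and the matrix applied to it. -/
private theorem mulVec_indicator_apply (G : Matrix (Orb Λ × Orb Λ) (Orb Λ × Orb Λ) ℂ)
    (f : Λ → Orb Λ × Orb Λ) (m : Orb Λ × Orb Λ) :
    (G *ᵥ fun j => ∑ r : Λ, if j = f r then (1 : ℂ) else 0) m = ∑ r : Λ, G m (f r) := by
  simp only [mulVec, dotProduct, Finset.mul_sum, mul_ite, mul_one, mul_zero]
  rw [Finset.sum_comm]
  simp only [Finset.sum_ite_eq', Finset.mem_univ, if_true]

/-- The indicator of a family of indices is a real vector. -/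
private theorem star_indicator (f : Λ → Orb Λ × Orb Λ) :
    star (fun j : Orb Λ × Orb Λ => ∑ r : Λ, if j = f r then (1 : ℂ) else 0) =
      fun j => ∑ r : Λ, if j = f r then (1 : ℂ) else 0 := by
  funext j
  simp only [Pi.star_apply, star_sum, apply_ite star, star_one, star_zero]

/-- The form of a matrix on the indicator of a family of indices `f`: `vᴴ G v = Σ_{pq} G_{f p, f q}`. -/
private theorem indicator_dotProduct_mulVec_indicator (G : Matrix (Orb Λ × Orb Λ) (Orb Λ × Orb Λ) ℂ)
    (f : Λ → Orb Λ × Orb Λ) :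
    star (fun j : Orb Λ × Orb Λ => ∑ r : Λ, if j = f r then (1 : ℂ) else 0) ⬝ᵥ
        (G *ᵥ fun j => ∑ r : Λ, if j = f r then (1 : ℂ) else 0) =
      ∑ p : Λ, ∑ q : Λ, G (f p) (f q) := by
  rw [star_indicator, dotProduct]
  simp only [mulVec_indicator_apply, Finset.sum_mul, ite_mul, one_mul, zero_mul]
  rw [Finset.sum_comm]
  simp only [Finset.sum_ite_eq', Finset.mem_univ, if_true]

/-- **REDUNDANCY LEMMA, E4a half** (FORMAT-qcl1 §5): if `G = gMap γ Γ ⪰ 0` and the E3 row holds in the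
`⟨Ŝ_−Ŝ_+⟩`-form `Σ_{pq} G_{(pβ,pα),(qβ,qα)} = 0`, then every maximal-projection row E4a holds:
`Σ_r G_{m,(rβ,rα)} = 0` for all `m` (the form of the PSD matrix `G` vanishes on the indicator `v` of the
members `(rβ, rα)`, so `G v = 0`). -/
theorem gMap_maximalProjection_of_E3 (hG : (gMap γ Γ).PosSemidef)
    (hE3 : ∑ p : Λ, ∑ q : Λ, gMap γ Γ (orb p 1, orb p 0) (orb q 1, orb q 0) = 0)
    (m : Orb Λ × Orb Λ) : ∑ r : Λ, gMap γ Γ m (orb r 1, orb r 0) = 0 := by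
  have h0 := indicator_dotProduct_mulVec_indicator (gMap γ Γ) fun r : Λ => (orb r 1, orb r 0)
  rw [hE3] at h0
  have hker := (hG.dotProduct_mulVec_zero_iff _).1 h0
  have := congr_fun hker m
  rwa [mulVec_indicator_apply] at this

/-- The `⟨Ŝ_+Ŝ_−⟩`-form minus the `⟨Ŝ_−Ŝ_+⟩`-form of `gMap γ Γ` is `tr γ^α − tr γ^β` once `Γ` is
antisymmetric in both index pairs (`[Ŝ_+, Ŝ_−] = 2Ŝ_z` at the level of abstract moments). -/
theorem gMap_sum_upDown_sub_sum_downUp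
    (hfst : ∀ i j q, Γ (j, i) q = -Γ (i, j) q) (hsnd : ∀ p k l, Γ p (l, k) = -Γ p (k, l)) :
    ∑ p : Λ, ∑ q : Λ, gMap γ Γ (orb p 0, orb p 1) (orb q 0, orb q 1) -
        ∑ p : Λ, ∑ q : Λ, gMap γ Γ (orb p 1, orb p 0) (orb q 1, orb q 0) =
      ∑ x : Λ, γ (orb x 0) (orb x 0) - ∑ x : Λ, γ (orb x 1) (orb x 1) := by
  have hΓ : ∑ p : Λ, ∑ q : Λ, Γ (orb p 0, orb q 1) (orb q 0, orb p 1) =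
      ∑ p : Λ, ∑ q : Λ, Γ (orb p 1, orb q 0) (orb q 1, orb p 0) := by
    rw [Finset.sum_comm]
    refine Finset.sum_congr rfl fun q _ => Finset.sum_congr rfl fun p _ => ?_
    rw [hfst, hsnd, neg_neg]
  simp only [gMap, orb_inj, and_true, Finset.sum_sub_distrib, Finset.sum_ite_eq, Finset.mem_univ,
    if_true]
  rw [hΓ]
  ring

/-- **REDUNDANCY LEMMA, E4b half** (FORMAT-qcl1 §5, `2S = 0`): if moreover `Γ` is fermionically
antisymmetric and the spin traces agree, `tr γ^α = tr γ^β` (the E1 rows of a balanced sector), then the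
E3 row also forces every E4b row `Σ_r G_{m,(rα,rβ)} = 0`. -/
theorem gMap_maximalProjection_flip_of_E3 (hG : (gMap γ Γ).PosSemidef)
    (hfst : ∀ i j q, Γ (j, i) q = -Γ (i, j) q) (hsnd : ∀ p k l, Γ p (l, k) = -Γ p (k, l))
    (htr : ∑ x : Λ, γ (orb x 0) (orb x 0) = ∑ x : Λ, γ (orb x 1) (orb x 1))
    (hE3 : ∑ p : Λ, ∑ q : Λ, gMap γ Γ (orb p 1, orb p 0) (orb q 1, orb q 0) = 0)
    (m : Orb Λ × Orb Λ) : ∑ r : Λ, gMap γ Γ m (orb r 0, orb r 1) = 0 := by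
  have hE3' : ∑ p : Λ, ∑ q : Λ, gMap γ Γ (orb p 0, orb p 1) (orb q 0, orb q 1) = 0 := by
    have h := gMap_sum_upDown_sub_sum_downUp (γ := γ) hfst hsnd
    rw [hE3, htr, sub_self, sub_zero] at h
    exact h
  have h0 := indicator_dotProduct_mulVec_indicator (gMap γ Γ) fun r : Λ => (orb r 0, orb r 1)
  rw [hE3'] at h0
  have hker := (hG.dotProduct_mulVec_zero_iff _).1 h0
  have := congr_fun hker m
  rwa [mulVec_indicator_apply] at this

/-- **feasible(`s2v`) = feasible(`s2`) for the cell's balanced-sector programme.** A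
sector-DQG-feasible pair at `(n, n)` that satisfies the E3 row (rhs `S(S+1) − M(M+1) = 0`) satisfies all
E4a and E4b rows. FORMAT-qcl1 §5 REDUNDANCY LEMMA. -/
theorem IsDQGFeasibleSector.maximalProjection_of_E3 {n : ℕ} (h : IsDQGFeasibleSector n n γ Γ)
    (hE3 : ∑ p : Λ, ∑ q : Λ, gMap γ Γ (orb p 1, orb p 0) (orb q 1, orb q 0) = 0)
    (m : Orb Λ × Orb Λ) :
    ∑ r : Λ, gMap γ Γ m (orb r 1, orb r 0) = 0 ∧ ∑ r : Λ, gMap γ Γ m (orb r 0, orb r 1) = 0 :=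
  ⟨gMap_maximalProjection_of_E3 h.dqg.g_psd hE3 m,
    gMap_maximalProjection_flip_of_E3 h.dqg.g_psd h.dqg.swap_fst h.dqg.swap_snd
      (by rw [h.trace_up, h.trace_down]) hE3 m⟩

end Abstract

/-! ## §3 From states to the abstract hypothesis (appended 2026-08-22, same seat) -/

/-- **The E3 hypothesis of §2 holds for the reduced density matrices of every vector annihilated by
`Ŝ_+`**: on `(oneRDM ψ, twoRDM ψ)` the `⟨Ŝ_−Ŝ_+⟩`-form of the `G`-map is `‖Ŝ_+ψ‖² = 0` (`gMap_rdm` +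
`sum_particleHoleRDM_eq_norm_spinPlus`) — so `gMap_maximalProjection_of_E3` /
`gMap_maximalProjection_flip_of_E3` apply to the pair of every state of the `S = M` class, recovering §1. -/
theorem sum_gMap_rdm_eq_zero_of_spinPlus_eq_zero {ψ : Fock (Orb Λ)} (hP : spinPlus *ᵥ ψ = 0) :
    ∑ p : Λ, ∑ q : Λ, gMap (oneRDM ψ) (twoRDM ψ) (orb p 1, orb p 0) (orb q 1, orb q 0) = 0 := by
  rw [gMap_rdm, sum_particleHoleRDM_eq_norm_spinPlus, hP, dotProduct_zero]

end Summit.Ventures.CertifiedQuantumChemistry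

end
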